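import Literature.NumberTheory.Automorphic.AutomorphicRepsGL
import Literature.NumberTheory.Automorphic.SatakeParametersGL
import Literature.NumberTheory.GaloisRepresentations.ArtinLFunction
import HarnessLib

/-!
# Artin automorphy of an automorphic representation: `π = π(σ)` (fact-free leaf)

The two PREDICATES by which a route says "the automorphic representation `π` of `GL_n(𝔸_F)` is
the automorphic image of the Artin representation `σ : Γ_F → GL_n(ℂ)`", and their three
unfolding lemmas, in a module whose import cone carries no named fact beyond the vocabulary of
`AutomorphicRepsGL` / `ArtinLFunction` themselves:

* `ArtinAutomorphy.FrobSatakeCompatibleAt σ π v` — `π_v = π(σ_v)` at an unramified finite place;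
* `ArtinAutomorphy.IsPiOfArtinRep σ π` — this holds at all but finitely many finite places;
* `ArtinAutomorphy.isPiOfArtinRep_iff`, `ArtinAutomorphy.IsPiOfArtinRep.eventually_isUnramifiedAt`,
  `ArtinAutomorphy.IsPiOfArtinRep.eventually_isUnramifiedAt_galois`.

## Why this file exists (cone hygiene; librarian sweep g20, promote event 964702)

Until now these five declarations lived only in
`Literature/NumberTheory/Automorphic/StrongArtinGL2.lean` (`Literature.NumberTheory.Automorphic.FrobSatakeCompatibleAt`,
`….IsPiOfArtinRep`, …), next to the strong-Artin named facts. Six Langlands theses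
(EvenIcosahedralCM, EvenArtinGL4Door, EvenArtinQuantumBoundary, GaloisWeightedBE,
HessianFirstBlood, PSL2ArtinDoor) import `StrongArtinGL2` ONLY to say `π = π(σ)`, and that import
drags the Langlands–Tunnell cases, the Deligne–Serre weight-one dictionary, ERH and Artin-conductor
facts into each route's module cone (this sweep's census: 52 modules / 22 undischarged named facts
in the cone of `StrongArtinGL2`, against 34 modules / 8 — all generic `AutomorphicRepsGL` /
`GaloisRep` vocabulary facts every Langlands route has anyway — in the cone of this file). The
bodies below are BYTE-IDENTICAL to the `StrongArtinGL2` originals; only the namespace is new. The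
gate's one-FQN-one-module rule (`dedup.fqn-exists`) forbids declaring the same fully-qualified
names in a second module while the first exists, so the move is done in two steps: (1) this leaf,
under the sub-namespace `ArtinAutomorphy` (the notion it names); (2) a follow-up proposal turns the
five `StrongArtinGL2` originals into `abbrev`/`alias`es of these (same constants thereafter; every
existing user keeps compiling). Until step (2) lands the two copies are definitionally equal
(`Iff.rfl` bridges them). Routes that only need `π = π(σ)` import THIS module and write
`ArtinAutomorphy.IsPiOfArtinRep σ π` (qualified: opening both `Literature.NumberTheory.Automorphic`
and `…ArtinAutomorphy` makes the bare name ambiguous until step (2)).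

Normalisations (verbatim from `StrongArtinGL2`): `π` is typed by the compactness fact
`hcpt : isCompact_glFiniteIntegralLevel n F` of `GLnAdelicStructure`; Satake parameters are
multisets `α` of cardinality `n` (`AutomorphicRepData.HasSatakeParamAt`), compared with `σ(Fr_v)`
through the characteristic polynomial `satakePolynomial α = ∏ (X - a)`.

## References

* J. Tunnell, *Artin's conjecture for representations of octahedral type*, Bull. AMS 5 (1981),
  p. 173. Bib key `Tunnell1981`.
* S. Gelbart, *Three lectures on the modularity of ρ̄_{E,3} and the Langlands reciprocity
  conjecture*, in Modular Forms and Fermat's Last Theorem (1997), Example 3.2.3, Thm. 2.1.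
  Bib key `Gelbart1997`.
-/

noncomputable section

open scoped MatrixGroups NumberField Polynomial Classical
open NumberField IsDedekindDomain Field Polynomial Literature.NumberTheory.Automorphic

namespace Literature.NumberTheory.Automorphic.ArtinAutomorphy

variable {n : ℕ} {F : Type} [Field F] [NumberField F] {hcpt : isCompact_glFiniteIntegralLevel n F}

/-- **`π_v = π(σ_v)` at an unramified finite place** (Tunnell 1981, p. 173; Gelbart 1997,
Example 3.2.3 and (2.6.1)–(2.6.2)): the automorphic representation `π` of `GL_n(𝔸_F)` has a
Satake parameter `α` at `v` (`AutomorphicRepData.HasSatakeParamAt`, so `π_v` is unramified),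
the Galois representation `σ : Γ_F → GL_n(ℂ)` is unramified at `v`, and every arithmetic
Frobenius at `v` has characteristic polynomial `∏_{a ∈ α} (X - a)`
(`Automorphic.satakePolynomial α`), i.e. the Langlands class `t_{π_v}` is conjugate to
`σ(Fr_v)`. Byte-identical to `Literature.NumberTheory.Automorphic.FrobSatakeCompatibleAt`
(`StrongArtinGL2.lean`), see the module docstring. [cite: Gelbart1997, Example 3.2.3] -/
def FrobSatakeCompatibleAt (σ : GaloisRepresentations.FramedArtinRep F n)
    (π : AutomorphicRepData (AutomorphyDatum.gl n F hcpt)) (v : HeightOneSpectrum (𝓞 F)) :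
    Prop :=
  ∃ α : Multiset ℂ, π.HasSatakeParamAt v α ∧ σ.IsUnramifiedAt v ∧
    σ.HasFrobCharpolyAt v (satakePolynomial α)

/-- **`π` equals `π(σ)`** in the sense of Tunnell (Bull. AMS 5 (1981), p. 173: "`π = ⊗ π_v`
with `π_v = π(ρ_v)` in the sense of [JL, §12] for almost all places `v` of `F`"; Gelbart 1997,
Thm. 2.1: "`trace(t_{π_v}) = trace σ(Fr_v)` for almost every prime `v` of `F`", together with
"central character `= det σ`"): `FrobSatakeCompatibleAt σ π v` for all but finitely many finite
places `v` (`Filter.cofinite`). When this holds the partial L-functions of `π` and `σ` agree.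
Byte-identical to `Literature.NumberTheory.Automorphic.IsPiOfArtinRep` (`StrongArtinGL2.lean`).
[cite: Tunnell1981, p. 173] -/
def IsPiOfArtinRep (σ : GaloisRepresentations.FramedArtinRep F n)
    (π : AutomorphicRepData (AutomorphyDatum.gl n F hcpt)) : Prop :=
  ∀ᶠ v in Filter.cofinite, FrobSatakeCompatibleAt σ π v

/-- Unfolding lemma for `IsPiOfArtinRep`. [folklore] -/
theorem isPiOfArtinRep_iff (σ : GaloisRepresentations.FramedArtinRep F n)
    (π : AutomorphicRepData (AutomorphyDatum.gl n F hcpt)) :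
    IsPiOfArtinRep σ π ↔ ∀ᶠ v in Filter.cofinite, FrobSatakeCompatibleAt σ π v :=
  Iff.rfl

/-- If `π = π(σ)` then `π` is unramified at almost all places (immediate). [folklore] -/
theorem IsPiOfArtinRep.eventually_isUnramifiedAt {σ : GaloisRepresentations.FramedArtinRep F n}
    {π : AutomorphicRepData (AutomorphyDatum.gl n F hcpt)} (h : IsPiOfArtinRep σ π) :
    ∀ᶠ v in Filter.cofinite, π.IsUnramifiedAt v :=
  h.mono fun _ ⟨α, hα, _⟩ => ⟨α, hα⟩

/-- If `π = π(σ)` then `σ` is unramified at almost all places (immediate). [folklore] -/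
theorem IsPiOfArtinRep.eventually_isUnramifiedAt_galois {σ : GaloisRepresentations.FramedArtinRep F n}
    {π : AutomorphicRepData (AutomorphyDatum.gl n F hcpt)} (h : IsPiOfArtinRep σ π) :
    ∀ᶠ v in Filter.cofinite, σ.IsUnramifiedAt v :=
  h.mono fun _ ⟨_, _, hσ, _⟩ => hσ

end Literature.NumberTheory.Automorphic.ArtinAutomorphy
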